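import Summits.ResolutionOfSingularities.KangarooAtlas.MizutaniHironakaSide
import HarnessLib

/-!
# Mizutani's `m(e)` VERBATIM in his own vocabulary: the smallest `dim Spec(S/U_+(𝔭)S)` over the points whose `U(𝔭) ∩ L` has exponent `≥ e`

Cell `pub-rosobs`, Mizutani enclosure (seat mizutani-encloser-2, gen 5). AI-written; AI review is weaker than expert
review; NOT a resolution-of-singularities theorem (summit relevance C).

> **Mizutani 1973, Remark 2.10 (p. 95).** "In general let `m(e)` be the smallest dimension of `H`-schemes whose exponents are
> not less than `e`. … It is quite likely that `m(e) = 2p^e − 1`."  **Def. 1.1.** "`B_{Pⁿ,p} = Spec(S/U_+(p)S)`."  **§1 (c).**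
> "We define the exponent of `B_{Pⁿ,p}` to be `e(U(p) ∩ L)`."

The tree's `mizutaniNumber p e := sInf (hsDims p e)` (gen 4, `MizutaniNumber.lean`, `mizutaniNumber_eq : = 2p^e − 1`) reads «dimension»
as Oda's `hsDim` and «exponent» as Oda's `exponent k p 𝔭`.  With encloser-1 g4's Oda equality (`hirForms_eq_invForms`,
`exponentLE_iff_hirForms`) and the hypothesis-free Thm 1.3 (`ringKrullDim_quotient_bIdeal_eq_hsDim_holds`), this file rewrites the
SET `hsDims p e` in Hironaka's / Mizutani's own terms — `dim` = the Krull dimension of `S ⧸ U_+(𝔭)S`, «exponent `≥ e`» = for every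
`e' < e` the graded `k[F]`-module `U(𝔭) ∩ L` is NOT generated from level `e'` — so that `mizutaniNumber_eq` IS Remark 2.10's conjecture
about Def. 1.1's objects, with no transcription left in the statement except «mult ≥ m» := `𝔭^{(m)}` (`symbPow`; = the order in
`𝒪_{Proj S,𝔭}`, encloser-1 g5's `MizutaniProjectiveOrder.lean`):

* `hirDims p e` — the set of `d : ℕ` with `ringKrullDim (S ⧸ U_+(𝔭)S) = d` for some point `𝔭` of some `ℙ^n_k` (`k` of characteristic `p`,
  in the universe `u`) such that `U(𝔭) ∩ L` is not generated from any level `e' < e`; **`hsDims_eq_hirDims`**;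
* **`mizutaniNumber_eq_sInf_hirDims`**, **`isLeast_hirDims`**, **`sInf_hirDims_eq : sInf (hirDims p e) = 2 * p ^ e − 1`**.

## References

* H. Mizutani, *Hironaka's additive group schemes*, Nagoya Math. J. 52 (1973) 85–95, Def. 1.1, §1 (c), Thm. 1.3, Remark 2.10.
  [Mizutani1973HironakaGroupSchemes]
-/

noncomputable section

open MvPolynomial Literature.AlgebraicGeometry.Resolution Literature.AlgebraicGeometry.Resolution.HironakaScheme

namespace Summit.ResolutionOfSingularities.KangarooAtlas.Mizutani

universe u

section HirDims

variable (p : ℕ) [hp : Fact p.Prime]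

/-- **The dimensions of the `H`-schemes of exponent `≥ e`, in Mizutani's own vocabulary**: `d ∈ hirDims p e` iff some point `𝔭` of
some `ℙ^n_k` (`char k = p`, `k : Type u`) has `dim B_{P,𝔭} = ringKrullDim (S ⧸ U_+(𝔭)S) = d` and `U(𝔭) ∩ L` (coefficient spaces
`hirForms k p 𝔭 j`) is NOT generated from any level `e' < e` (`e(U(𝔭) ∩ L) ≥ e`, §1 (c)).
[cite: Mizutani1973HironakaGroupSchemes, Remark 2.10 (p. 95), Def. 1.1, §1 (c)] -/
def hirDims (e : ℕ) : Set ℕ :=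
  {d | ∃ (k : Type u) (_ : Field k) (_ : CharP k p) (n : ℕ) (𝔭 : Ideal (MvPolynomial (Fin (n + 1)) k)) (_ : 𝔭.IsPrime),
    IsPoint k 𝔭 ∧
      (∀ e', e' < e → ¬ ∀ j, e' ≤ j → hirForms k p 𝔭 j =
        Submodule.span k (frobVec k p (j - e') '' (hirForms k p 𝔭 e' : Set (Fin (n + 1) → k)))) ∧
      ringKrullDim (MvPolynomial (Fin (n + 1)) k ⧸ bIdeal k 𝔭) = (d : WithBot ℕ∞)}

/-- «exponent `≥ e`» in Oda's number `exponent k p 𝔭` iff `U(𝔭) ∩ L` is not generated from any level `e' < e`.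
[cite: Mizutani1973HironakaGroupSchemes, §1 (c)] -/
theorem le_exponent_iff_hirForms {k : Type u} [Field k] [CharP k p] {n : ℕ} (𝔭 : Ideal (MvPolynomial (Fin (n + 1)) k))
    [𝔭.IsPrime] (e : ℕ) :
    e ≤ exponent k p 𝔭 ↔ ∀ e', e' < e → ¬ ∀ j, e' ≤ j → hirForms k p 𝔭 j =
      Submodule.span k (frobVec k p (j - e') '' (hirForms k p 𝔭 e' : Set (Fin (n + 1) → k))) := by
  rw [le_exponent_iff]
  simp only [exponentLE_iff_hirForms]

/-- **Oda's reading and Mizutani's reading of «the dimensions of the H-schemes of exponent `≥ e`» give the same set.**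
[cite: Mizutani1973HironakaGroupSchemes, Remark 2.10, Thm. 1.3] -/
theorem hsDims_eq_hirDims (e : ℕ) : hsDims.{u} p e = hirDims.{u} p e := by
  ext d
  constructor
  · rintro ⟨k, _, _, n, 𝔭, hP, he, hd⟩
    haveI : 𝔭.IsPrime := hP.1
    refine ⟨k, inferInstance, inferInstance, n, 𝔭, inferInstance, hP, (le_exponent_iff_hirForms p 𝔭 e).mp he, ?_⟩
    rw [ringKrullDim_quotient_bIdeal_eq_hsDim_holds k p 𝔭 hP, hd]
  · rintro ⟨k, _, _, n, 𝔭, _, hP, he, hd⟩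
    refine ⟨k, inferInstance, inferInstance, n, 𝔭, hP, (le_exponent_iff_hirForms p 𝔭 e).mpr he, ?_⟩
    rw [ringKrullDim_quotient_bIdeal_eq_hsDim_holds k p 𝔭 hP] at hd
    exact_mod_cast hd

/-- **Mizutani's `m(e)` is the infimum of `hirDims p e`** — Remark 2.10 verbatim about the objects of Def. 1.1 and §1 (c).
[cite: Mizutani1973HironakaGroupSchemes, Remark 2.10 (p. 95)] -/
theorem mizutaniNumber_eq_sInf_hirDims (e : ℕ) : mizutaniNumber.{u} p e = sInf (hirDims.{u} p e) := by
  rw [mizutaniNumber, hsDims_eq_hirDims]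

/-- `2p^e − 1` is the least element of `hirDims p e`. [cite: Mizutani1973HironakaGroupSchemes, Remark 2.10 (p. 95)] -/
theorem isLeast_hirDims (e : ℕ) : IsLeast (hirDims.{u} p e) (2 * p ^ e - 1) := by
  rw [← hsDims_eq_hirDims]
  exact isLeast_hsDims p e

/-- **MIZUTANI'S CONJECTURE `m(e) = 2p^e − 1` STATED ON HIS OWN OBJECTS**: the least `dim Spec(S/U_+(𝔭)S)` over all points `𝔭` of all
`ℙ^n_k` (`char k = p`) whose `U(𝔭) ∩ L` has exponent `≥ e` is `2p^e − 1`, for every prime `p` and every `e`.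
[cite: Mizutani1973HironakaGroupSchemes, Remark 2.10 (p. 95: "It is quite likely that m(e) = 2p^e − 1")] -/
theorem sInf_hirDims_eq (e : ℕ) : sInf (hirDims.{u} p e) = 2 * p ^ e - 1 :=
  (isLeast_hirDims.{u} p e).csInf_eq

end HirDims

end Summit.ResolutionOfSingularities.KangarooAtlas.Mizutani

end
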